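import Literature.MathematicalPhysics.QuantumFieldTheory.Balaban1983to89.B4Eq19LatticeCaccioppoli
import HarnessLib

/-!
# Line «sandwich_discharge» on crux `HistoryTailL` (stmt-QuantumFields-19936), stub `stub_sandwichSweepGapCapped` (S′), brick B5 on `ℤ³` —
# (Z-b) «CUTOFF COMMUTATORS»: the standard `1∕R`-Lipschitz lattice cutoff, the product rule WITH COMMUTATOR for the abelian lattice curl of a
# truncated 1-form, its degree-2→3 twin, the shell where the commutators live, and the pairing estimate against a bounded 2-form

Cell `ym3-torus` (YM ladder rung R3 = continuum SU(2) Yang–Mills on the three-torus — a RUNG, NOT the Clay problem: not d = 4, not infinite volume,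
not a mass gap); width seat `ym3-torus-px8` gen 7; `--supports stmt-QuantumFields-19936` (helper).  THEOREMS ONLY (0 `def`, default heartbeats), in the
`ℤ^d` letters of lit ✓`B4Eq19LatticeOperators` (`Zd`, `unitVec`, `box`); generic `d` throughout.

WHY (w8 g8 LOCATE-B5-Z3-COMMUTATOR §3 (i)(ii)(iii)(v) ∕ §6 (Z-b); px8 g6 ARCH-S′ §3).  The sweep amplitude of the capped stub is the TRUNCATED potential
`a_R := χ·a` of the dipole-matched 2-form `ω` (`a = δ₂(G₀ ∗ ω)` on `ℤ³`).  Against a 2-form `F`, `⟨d a_R, F⟩ = ⟨ω, F⟩ +` two COMMUTATOR terms: the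
degree-1→2 commutator `E₁ = d(χa) − χ·da` (§3) and the degree-2→3 commutator `E₂ = χ·δ₃γ − δ₃(χγ)` (§4, `γ = d₂(G₀ ∗ ω)`), both supported on the SHELL
where `χ` is not locally constant and both `O(R⁻¹ × the local size of a ∕ γ)` pointwise; the pairing with `F` then costs `sup|F| × ‖E‖_{ℓ¹(shell)}` (§5).
* §2 ★`exists_cutoff_box_two_box`: for `p : Zd d`, `1 ≤ R`, a cutoff `χ : Zd d → ℝ` with `0 ≤ χ ≤ 1`, `χ = 1` on `box p R`, `χ = 0` off `box p (2R)`,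
  and `|χ(x ± e_μ) − χ(x)| ≤ 1∕R` — an INSTANCE of lit ✓`B4Eq19LatticeCaccioppoli.exists_cutoff` (`ρ := R − 1`, `s := R + 1`; cited, not restated), with
  the backward-step bound added.
* §3 ★`curl_mul_eq_mul_curl_add_comm`: in the token order of lit ✓`B9Eq39Adjoint.curl` (abelian: `a x μ + a (x+e_μ) ν − a (x+e_ν) μ − a x ν`), and
  `curl_mul_eq_of_letter` in (Z-a)'s letter shape (`da` a free symbol pinned by `hda`): `curl(χ•a) = χ(x)·curl a + E₁` with `E₁ = (χ(x+e_μ) − χ x)·a(x+e_μ) ν − (χ(x+e_ν) − χ x)·a(x+e_ν) μ`; `|E₁| ≤ ρ·(|a(x+e_μ) ν| + |a(x+e_ν) μ|)` under a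
  `ρ`-Lipschitz `χ`; `E₁ = 0` on `box p (R−1)` and off `box p (2R+1)` for the standard cutoff.
* §4 ★`mul_bdiff_sub_bdiff_mul` (and the forward twin): for scalars `χ, ψ` and a direction `κ`, `χ(x)·(ψ(x−e_κ) − ψ x) − ((χψ)(x−e_κ) − (χψ)(x)) =
  (χ x − χ(x−e_κ))·ψ(x−e_κ)`; SUMMED over `κ` in (Z-a)'s `δ₃` letter (`(δ₃H)(x,μ,ν) = Σ_κ[H(x−e_κ,κ,μ,ν) − H(x,κ,μ,ν)]`, seat px6 g8
  `CovariantDischargeLatticeFormsDeg23`): ★`mul_deltaThree_sub_deltaThree_mul` `χ(x)·(δ₃H)(x,μ,ν) − δ₃(χ̂H)(x,μ,ν) = Σ_κ (χ x − χ(x−e_κ))·H(x−e_κ,κ,μ,ν)`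
  (`= −E₂`), `_of_letter` form with free symbols; bound `≤ ρ·Σ_κ|H(x−e_κ,κ,μ,ν)|`; vanishing on the plateau and outside.
* §5 `abs_sum_mul_le_of_abs_le` (`|Σ E·F| ≤ θ·Σ|E|` when `|F| ≤ θ` on the range) and `sum_abs_le_sum_abs_shell` (an `E` vanishing on `box p (R−1)` and off
  `box p (2R+1)` has `Σ_B |E| ≤ Σ_{box p (2R+1) ∖ box p (R−1)} |E|` for every finite `B`).
Text-independent of the stub and of bricks (Z-a)(Z-c)(Z-d); the knit (Z-e) instantiates `a := δ₂(G₀ ∗ ω)`, `ψ := d₂(G₀ ∗ ω)`, `ρ := 1∕R`.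
HONEST SCOPE: elementary identities and finite sums; NOTHING here proves B5, the capped stub, `HistoryTailL`, or any summit statement; YM₃ on T³ is rung R3,
not Clay. [folklore] (cf. Giaquinta, *Multiple integrals in the calculus of variations* (1983) Ch. III §2, cutoff functions).
-/

noncomputable section

open scoped BigOperators
open Finset

namespace Summit.QuantumFields.YangMills.Theorems.CovariantDischargeCutoffCommutator

open Literature.MathematicalPhysics.QuantumFieldTheory.Balaban1983to89.B4Eq19LatticeOperators
open Literature.MathematicalPhysics.QuantumFieldTheory.Balaban1983to89 (B4Eq19LatticeCaccioppoli.exists_cutoff)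

variable {d : ℕ}

/-! ## §2 The standard `1∕R`-Lipschitz cutoff between `box p R` and `box p (2R)` -/

/-- ★ **THE STANDARD CUTOFF** (instance of lit `B4Eq19LatticeCaccioppoli.exists_cutoff` at `ρ := R − 1`, `s := R + 1`).  For a centre `p ∈ ℤ^d` and a
radius `R ≥ 1` there is `χ : ℤ^d → [0,1]` with `χ = 1` on `box p R`, `χ = 0` off `box p (2R)`, and `|χ(x + e_μ) − χ(x)| ≤ 1∕R`,
`|χ(x − e_μ) − χ(x)| ≤ 1∕R` for all `x, μ`. [folklore] [cite: Giaquinta1984, Ch. III §2 p.77] -/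
theorem exists_cutoff_box_two_box (p : Zd d) {R : ℕ} (hR : 1 ≤ R) :
    ∃ χ : Zd d → ℝ, (∀ x, 0 ≤ χ x ∧ χ x ≤ 1) ∧ (∀ x ∈ box p R, χ x = 1) ∧ (∀ x, x ∉ box p (2 * (R : ℤ)) → χ x = 0) ∧
      (∀ x μ, |χ (x + unitVec μ) - χ x| ≤ 1 / R) ∧ (∀ x μ, |χ (x - unitVec μ) - χ x| ≤ 1 / R) := by
  obtain ⟨χ, h0, h1, hin, hout, hlip⟩ :=
    B4Eq19LatticeCaccioppoli.exists_cutoff p (ρ := (R : ℤ) - 1) (s := (R : ℤ) + 1) (by omega) (by omega)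
  have hR0 : (0 : ℝ) < R := by exact_mod_cast hR
  have hs : (1 : ℝ) / (((R : ℤ) + 1 : ℤ) : ℝ) ≤ 1 / R := by
    rw [one_div_le_one_div (by push_cast; linarith) hR0]
    push_cast; linarith
  refine ⟨χ, fun x => ⟨h0 x, h1 x⟩, fun x hx => hin x (by rwa [sub_add_cancel]), fun x hx => hout x ?_, fun x μ => (hlip x μ).trans hs,
    fun x μ => ?_⟩
  · rwa [show (R : ℤ) - 1 + ((R : ℤ) + 1) = 2 * (R : ℤ) by ring]
  · have h := hlip (x - unitVec μ) μ
    rw [sub_add_cancel, abs_sub_comm] at h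
    exact h.trans hs

/-! ## §3 Degree 1 → 2: the product rule with commutator for the abelian lattice curl -/

/-- ★ **PRODUCT RULE WITH COMMUTATOR** (abelian lattice curl in the token order of lit `B9Eq39Adjoint.curl`):
`curl(χ•a)(x; μ, ν) = χ(x)·curl a(x; μ, ν) + [(χ(x+e_μ) − χ(x))·a(x+e_μ, ν) − (χ(x+e_ν) − χ(x))·a(x+e_ν, μ)]`. [folklore] -/
theorem curl_mul_eq_mul_curl_add_comm (χ : Zd d → ℝ) (a : Zd d → Fin d → ℝ) (x : Zd d) (μ ν : Fin d) :
    χ x * a x μ + χ (x + unitVec μ) * a (x + unitVec μ) ν - χ (x + unitVec ν) * a (x + unitVec ν) μ - χ x * a x ν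
      = χ x * (a x μ + a (x + unitVec μ) ν - a (x + unitVec ν) μ - a x ν)
        + ((χ (x + unitVec μ) - χ x) * a (x + unitVec μ) ν - (χ (x + unitVec ν) - χ x) * a (x + unitVec ν) μ) := by
  ring

/-- The same product rule in the LETTER SHAPE of (Z-a) (`CovariantDischargeLatticeFormsDeg23`: `(d₁a)(x,μ,ν) = (a(x+e_μ,ν) − a(x,ν)) − (a(x+e_ν,μ) − a(x,μ))`,
free symbol `da` pinned by `hda`): `d₁(χ•a)(x,μ,ν) = χ(x)·(d₁a)(x,μ,ν) + E₁(x,μ,ν)`. [folklore] -/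
theorem curl_mul_eq_of_letter (χ : Zd d → ℝ) (a : Zd d → Fin d → ℝ) (da : Zd d → Fin d → Fin d → ℝ)
    (hda : ∀ x μ ν, da x μ ν = (a (x + unitVec μ) ν - a x ν) - (a (x + unitVec ν) μ - a x μ)) (x : Zd d) (μ ν : Fin d) :
    (χ (x + unitVec μ) * a (x + unitVec μ) ν - χ x * a x ν) - (χ (x + unitVec ν) * a (x + unitVec ν) μ - χ x * a x μ)
      = χ x * da x μ ν
        + ((χ (x + unitVec μ) - χ x) * a (x + unitVec μ) ν - (χ (x + unitVec ν) - χ x) * a (x + unitVec ν) μ) := by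
  rw [hda]; ring

/-- The degree-1→2 commutator is `O(ρ × local size of a)` for a `ρ`-Lipschitz cutoff:
`|(χ(x+e_μ) − χ x)·a(x+e_μ, ν) − (χ(x+e_ν) − χ x)·a(x+e_ν, μ)| ≤ ρ·(|a(x+e_μ, ν)| + |a(x+e_ν, μ)|)`. [folklore] -/
theorem abs_curl_comm_le {χ : Zd d → ℝ} {ρ : ℝ} (hχ : ∀ x μ, |χ (x + unitVec μ) - χ x| ≤ ρ)
    (a : Zd d → Fin d → ℝ) (x : Zd d) (μ ν : Fin d) :
    |(χ (x + unitVec μ) - χ x) * a (x + unitVec μ) ν - (χ (x + unitVec ν) - χ x) * a (x + unitVec ν) μ|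
      ≤ ρ * (|a (x + unitVec μ) ν| + |a (x + unitVec ν) μ|) := by
  have h1 : |(χ (x + unitVec μ) - χ x) * a (x + unitVec μ) ν| ≤ ρ * |a (x + unitVec μ) ν| := by
    rw [abs_mul]; exact mul_le_mul_of_nonneg_right (hχ x μ) (abs_nonneg _)
  have h2 : |(χ (x + unitVec ν) - χ x) * a (x + unitVec ν) μ| ≤ ρ * |a (x + unitVec ν) μ| := by
    rw [abs_mul]; exact mul_le_mul_of_nonneg_right (hχ x ν) (abs_nonneg _)
  calc |(χ (x + unitVec μ) - χ x) * a (x + unitVec μ) ν - (χ (x + unitVec ν) - χ x) * a (x + unitVec ν) μ|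
      ≤ |(χ (x + unitVec μ) - χ x) * a (x + unitVec μ) ν| + |(χ (x + unitVec ν) - χ x) * a (x + unitVec ν) μ| := abs_sub _ _
    _ ≤ ρ * |a (x + unitVec μ) ν| + ρ * |a (x + unitVec ν) μ| := add_le_add h1 h2
    _ = ρ * (|a (x + unitVec μ) ν| + |a (x + unitVec ν) μ|) := by ring

/-- The degree-1→2 commutator vanishes wherever the cutoff is constant across the plaquette's forward corner. [folklore] -/
theorem curl_comm_eq_zero_of_const {χ : Zd d → ℝ} {x : Zd d} {μ ν : Fin d} (hμ : χ (x + unitVec μ) = χ x) (hν : χ (x + unitVec ν) = χ x)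
    (a : Zd d → Fin d → ℝ) :
    (χ (x + unitVec μ) - χ x) * a (x + unitVec μ) ν - (χ (x + unitVec ν) - χ x) * a (x + unitVec ν) μ = 0 := by
  rw [hμ, hν]; ring

/-- On the PLATEAU: if `χ = 1` on `box p R` and `x ∈ box p (R − 1)`, the degree-1→2 commutator at `x` vanishes. [folklore] -/
theorem curl_comm_eq_zero_of_mem_box {χ : Zd d → ℝ} {p : Zd d} {R : ℤ} (h1 : ∀ y ∈ box p R, χ y = 1) {x : Zd d}
    (hx : x ∈ box p (R - 1)) (a : Zd d → Fin d → ℝ) (μ ν : Fin d) :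
    (χ (x + unitVec μ) - χ x) * a (x + unitVec μ) ν - (χ (x + unitVec ν) - χ x) * a (x + unitVec ν) μ = 0 := by
  have hx0 : x ∈ box p R := box_mono p (by linarith) hx
  have hμ : x + unitVec μ ∈ box p R := by simpa using add_unitVec_mem_box hx μ
  have hν : x + unitVec ν ∈ box p R := by simpa using add_unitVec_mem_box hx ν
  exact curl_comm_eq_zero_of_const (by rw [h1 _ hμ, h1 _ hx0]) (by rw [h1 _ hν, h1 _ hx0]) a

/-- OUTSIDE: if `χ = 0` off `box p S` and `x ∉ box p (S + 1)`, the degree-1→2 commutator at `x` vanishes. [folklore] -/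
theorem curl_comm_eq_zero_of_not_mem_box {χ : Zd d → ℝ} {p : Zd d} {S : ℤ} (h0 : ∀ y, y ∉ box p S → χ y = 0) {x : Zd d}
    (hx : x ∉ box p (S + 1)) (a : Zd d → Fin d → ℝ) (μ ν : Fin d) :
    (χ (x + unitVec μ) - χ x) * a (x + unitVec μ) ν - (χ (x + unitVec ν) - χ x) * a (x + unitVec ν) μ = 0 := by
  have hx0 : x ∉ box p S := fun h => hx (box_mono p (by linarith) h)
  have hμ : x + unitVec μ ∉ box p S := add_unitVec_not_mem_box hx μ
  have hν : x + unitVec ν ∉ box p S := add_unitVec_not_mem_box hx ν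
  exact curl_comm_eq_zero_of_const (by rw [h0 _ hμ, h0 _ hx0]) (by rw [h0 _ hν, h0 _ hx0]) a

/-! ## §4 Degree 2 → 3: the scalar commutator of a cutoff with a backward (forward) difference -/

/-- ★ **THE DEGREE-2→3 COMMUTATOR** (scalar form, any orientation convention): for scalars `χ, ψ` on `ℤ^d` and a direction `κ`,
`χ(x)·(ψ(x−e_κ) − ψ(x)) − ((χψ)(x−e_κ) − (χψ)(x)) = (χ(x) − χ(x−e_κ))·ψ(x−e_κ)` — multiplying the cutoff INSIDE a backward difference versus
OUTSIDE differs by a term carried by ONE value of `ψ` and ONE increment of `χ`. [folklore] -/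
theorem mul_bdiff_sub_bdiff_mul (χ ψ : Zd d → ℝ) (x : Zd d) (κ : Fin d) :
    χ x * (ψ (x - unitVec κ) - ψ x) - (χ (x - unitVec κ) * ψ (x - unitVec κ) - χ x * ψ x)
      = (χ x - χ (x - unitVec κ)) * ψ (x - unitVec κ) := by
  ring

/-- The forward twin: `χ(x)·(ψ(x+e_κ) − ψ(x)) − ((χψ)(x+e_κ) − (χψ)(x)) = (χ(x) − χ(x+e_κ))·ψ(x+e_κ)`. [folklore] -/
theorem mul_fdiff_sub_fdiff_mul (χ ψ : Zd d → ℝ) (x : Zd d) (κ : Fin d) :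
    χ x * (ψ (x + unitVec κ) - ψ x) - (χ (x + unitVec κ) * ψ (x + unitVec κ) - χ x * ψ x)
      = (χ x - χ (x + unitVec κ)) * ψ (x + unitVec κ) := by
  ring

/-- ★ **THE DEGREE-2→3 COMMUTATOR, SUMMED** — in the LETTER SHAPE of (Z-a)'s `δ₃` (`(δ₃H)(x,μ,ν) = Σ_κ [H(x−e_κ,κ,μ,ν) − H(x,κ,μ,ν)]`):
`χ(x)·(δ₃H)(x,μ,ν) − (δ₃(χ̂H))(x,μ,ν) = Σ_κ (χ(x) − χ(x−e_κ))·H(x−e_κ,κ,μ,ν)` where `(χ̂H)(y,·) = χ(y)·H(y,·)`. [folklore] -/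
theorem mul_deltaThree_sub_deltaThree_mul (χ : Zd d → ℝ) (H : Zd d → Fin d → Fin d → Fin d → ℝ) (x : Zd d) (μ ν : Fin d) :
    χ x * (∑ κ, (H (x - unitVec κ) κ μ ν - H x κ μ ν)) - ∑ κ, (χ (x - unitVec κ) * H (x - unitVec κ) κ μ ν - χ x * H x κ μ ν)
      = ∑ κ, (χ x - χ (x - unitVec κ)) * H (x - unitVec κ) κ μ ν := by
  rw [Finset.mul_sum, ← Finset.sum_sub_distrib]
  exact Finset.sum_congr rfl fun κ _ => mul_bdiff_sub_bdiff_mul χ (fun y => H y κ μ ν) x κ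

/-- The same with (Z-a)'s free symbols: `δH` pinned by `hδH` for `H` and `δK` pinned by `hδK` for `K := χ̂H`. [folklore] -/
theorem mul_deltaThree_sub_deltaThree_mul_of_letter (χ : Zd d → ℝ) (H K : Zd d → Fin d → Fin d → Fin d → ℝ)
    (δH δK : Zd d → Fin d → Fin d → ℝ) (hK : ∀ y κ μ ν, K y κ μ ν = χ y * H y κ μ ν)
    (hδH : ∀ x μ ν, δH x μ ν = ∑ κ, (H (x - unitVec κ) κ μ ν - H x κ μ ν))
    (hδK : ∀ x μ ν, δK x μ ν = ∑ κ, (K (x - unitVec κ) κ μ ν - K x κ μ ν)) (x : Zd d) (μ ν : Fin d) :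
    χ x * δH x μ ν - δK x μ ν = ∑ κ, (χ x - χ (x - unitVec κ)) * H (x - unitVec κ) κ μ ν := by
  rw [hδH, hδK]
  simp only [hK]
  exact mul_deltaThree_sub_deltaThree_mul χ H x μ ν

/-- The summed degree-2→3 commutator is `O(ρ × the d backward values of H)` for a `ρ`-Lipschitz cutoff. [folklore] -/
theorem abs_deltaThree_comm_le {χ : Zd d → ℝ} {ρ : ℝ} (hχ : ∀ x μ, |χ (x - unitVec μ) - χ x| ≤ ρ)
    (H : Zd d → Fin d → Fin d → Fin d → ℝ) (x : Zd d) (μ ν : Fin d) :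
    |∑ κ, (χ x - χ (x - unitVec κ)) * H (x - unitVec κ) κ μ ν| ≤ ρ * ∑ κ, |H (x - unitVec κ) κ μ ν| := by
  refine (Finset.abs_sum_le_sum_abs _ _).trans ?_
  rw [Finset.mul_sum]
  refine Finset.sum_le_sum fun κ _ => ?_
  rw [abs_mul, abs_sub_comm]
  exact mul_le_mul_of_nonneg_right (hχ x κ) (abs_nonneg _)

/-- On the PLATEAU the summed degree-2→3 commutator vanishes. [folklore] -/
theorem deltaThree_comm_eq_zero_of_mem_box {χ : Zd d → ℝ} {p : Zd d} {R : ℤ} (h1 : ∀ y ∈ box p R, χ y = 1) {x : Zd d}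
    (hx : x ∈ box p (R - 1)) (H : Zd d → Fin d → Fin d → Fin d → ℝ) (μ ν : Fin d) :
    ∑ κ, (χ x - χ (x - unitVec κ)) * H (x - unitVec κ) κ μ ν = 0 := by
  refine Finset.sum_eq_zero fun κ _ => ?_
  have hx0 : x ∈ box p R := box_mono p (by linarith) hx
  have hκ : x - unitVec κ ∈ box p R := by simpa using sub_unitVec_mem_box hx κ
  rw [h1 _ hx0, h1 _ hκ]; ring

/-- OUTSIDE the summed degree-2→3 commutator vanishes. [folklore] -/
theorem deltaThree_comm_eq_zero_of_not_mem_box {χ : Zd d → ℝ} {p : Zd d} {S : ℤ} (h0 : ∀ y, y ∉ box p S → χ y = 0) {x : Zd d}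
    (hx : x ∉ box p (S + 1)) (H : Zd d → Fin d → Fin d → Fin d → ℝ) (μ ν : Fin d) :
    ∑ κ, (χ x - χ (x - unitVec κ)) * H (x - unitVec κ) κ μ ν = 0 := by
  refine Finset.sum_eq_zero fun κ _ => ?_
  have hx0 : x ∉ box p S := fun h => hx (box_mono p (by linarith) h)
  have hκ : x - unitVec κ ∉ box p S := sub_unitVec_not_mem_box hx κ
  rw [h0 _ hx0, h0 _ hκ]; ring

/-- The backward degree-2→3 commutator is `O(ρ·|ψ(x − e_κ)|)` for a `ρ`-Lipschitz cutoff. [folklore] -/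
theorem abs_bdiff_comm_le {χ : Zd d → ℝ} {ρ : ℝ} (hχ : ∀ x μ, |χ (x - unitVec μ) - χ x| ≤ ρ) (ψ : Zd d → ℝ) (x : Zd d) (κ : Fin d) :
    |(χ x - χ (x - unitVec κ)) * ψ (x - unitVec κ)| ≤ ρ * |ψ (x - unitVec κ)| := by
  rw [abs_mul, abs_sub_comm]
  exact mul_le_mul_of_nonneg_right (hχ x κ) (abs_nonneg _)

/-- The forward degree-2→3 commutator is `O(ρ·|ψ(x + e_κ)|)` for a `ρ`-Lipschitz cutoff. [folklore] -/
theorem abs_fdiff_comm_le {χ : Zd d → ℝ} {ρ : ℝ} (hχ : ∀ x μ, |χ (x + unitVec μ) - χ x| ≤ ρ) (ψ : Zd d → ℝ) (x : Zd d) (κ : Fin d) :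
    |(χ x - χ (x + unitVec κ)) * ψ (x + unitVec κ)| ≤ ρ * |ψ (x + unitVec κ)| := by
  rw [abs_mul, abs_sub_comm]
  exact mul_le_mul_of_nonneg_right (hχ x κ) (abs_nonneg _)

/-- On the PLATEAU: if `χ = 1` on `box p R` and `x ∈ box p (R − 1)`, the backward commutator at `x` vanishes. [folklore] -/
theorem bdiff_comm_eq_zero_of_mem_box {χ : Zd d → ℝ} {p : Zd d} {R : ℤ} (h1 : ∀ y ∈ box p R, χ y = 1) {x : Zd d}
    (hx : x ∈ box p (R - 1)) (ψ : Zd d → ℝ) (κ : Fin d) :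
    (χ x - χ (x - unitVec κ)) * ψ (x - unitVec κ) = 0 := by
  have hx0 : x ∈ box p R := box_mono p (by linarith) hx
  have hκ : x - unitVec κ ∈ box p R := by simpa using sub_unitVec_mem_box hx κ
  rw [h1 _ hx0, h1 _ hκ]; ring

/-- On the PLATEAU (forward twin). [folklore] -/
theorem fdiff_comm_eq_zero_of_mem_box {χ : Zd d → ℝ} {p : Zd d} {R : ℤ} (h1 : ∀ y ∈ box p R, χ y = 1) {x : Zd d}
    (hx : x ∈ box p (R - 1)) (ψ : Zd d → ℝ) (κ : Fin d) :
    (χ x - χ (x + unitVec κ)) * ψ (x + unitVec κ) = 0 := by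
  have hx0 : x ∈ box p R := box_mono p (by linarith) hx
  have hκ : x + unitVec κ ∈ box p R := by simpa using add_unitVec_mem_box hx κ
  rw [h1 _ hx0, h1 _ hκ]; ring

/-- OUTSIDE: if `χ = 0` off `box p S` and `x ∉ box p (S + 1)`, the backward commutator at `x` vanishes. [folklore] -/
theorem bdiff_comm_eq_zero_of_not_mem_box {χ : Zd d → ℝ} {p : Zd d} {S : ℤ} (h0 : ∀ y, y ∉ box p S → χ y = 0) {x : Zd d}
    (hx : x ∉ box p (S + 1)) (ψ : Zd d → ℝ) (κ : Fin d) :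
    (χ x - χ (x - unitVec κ)) * ψ (x - unitVec κ) = 0 := by
  have hx0 : x ∉ box p S := fun h => hx (box_mono p (by linarith) h)
  have hκ : x - unitVec κ ∉ box p S := sub_unitVec_not_mem_box hx κ
  rw [h0 _ hx0, h0 _ hκ]; ring

/-- OUTSIDE (forward twin). [folklore] -/
theorem fdiff_comm_eq_zero_of_not_mem_box {χ : Zd d → ℝ} {p : Zd d} {S : ℤ} (h0 : ∀ y, y ∉ box p S → χ y = 0) {x : Zd d}
    (hx : x ∉ box p (S + 1)) (ψ : Zd d → ℝ) (κ : Fin d) :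
    (χ x - χ (x + unitVec κ)) * ψ (x + unitVec κ) = 0 := by
  have hx0 : x ∉ box p S := fun h => hx (box_mono p (by linarith) h)
  have hκ : x + unitVec κ ∉ box p S := add_unitVec_not_mem_box hx κ
  rw [h0 _ hx0, h0 _ hκ]; ring

/-! ## §5 Pairing against a bounded 2-form and the shell bookkeeping -/

/-- **PAIRING ESTIMATE**: if `|F| ≤ θ` on the range of summation then `|Σ E·F| ≤ θ·Σ|E|`. [folklore] -/
theorem abs_sum_mul_le_of_abs_le {ι : Type*} (s : Finset ι) (E F : ι → ℝ) {θ : ℝ} (hF : ∀ i ∈ s, |F i| ≤ θ) :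
    |∑ i ∈ s, E i * F i| ≤ θ * ∑ i ∈ s, |E i| := by
  refine (Finset.abs_sum_le_sum_abs _ _).trans ?_
  rw [Finset.mul_sum]
  refine Finset.sum_le_sum fun i hi => ?_
  rw [abs_mul, mul_comm]
  exact mul_le_mul_of_nonneg_right (hF i hi) (abs_nonneg _)

/-- **SHELL BOOKKEEPING**: a function vanishing on `box p r` and off `box p s` has, over ANY finite set, `ℓ¹` mass at most its mass on the shell
`box p s ∖ box p r`. [folklore] -/
theorem sum_abs_le_sum_abs_shell (E : Zd d → ℝ) (p : Zd d) (r s : ℤ) (hin : ∀ x ∈ box p r, E x = 0) (hout : ∀ x, x ∉ box p s → E x = 0)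
    (B : Finset (Zd d)) :
    ∑ x ∈ B, |E x| ≤ ∑ x ∈ box p s \ box p r, |E x| := by
  classical
  have hsplit : ∑ x ∈ B, |E x| = ∑ x ∈ B ∩ (box p s \ box p r), |E x| := by
    refine (Finset.sum_subset Finset.inter_subset_left fun x hxB hx => ?_).symm
    rw [Finset.mem_inter, not_and, Finset.mem_sdiff, not_and, not_not] at hx
    by_cases hs : x ∈ box p s
    · rw [hin x (hx hxB hs), abs_zero]
    · rw [hout x hs, abs_zero]
  rw [hsplit]
  exact Finset.sum_le_sum_of_subset_of_nonneg Finset.inter_subset_right fun x _ _ => abs_nonneg _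

/-- The shell mass of a pointwise-dominated function: if `|E x| ≤ ρ·g x` on the shell then `Σ_shell |E| ≤ ρ·Σ_shell g`. [folklore] -/
theorem sum_abs_le_mul_sum_of_le {ι : Type*} (s : Finset ι) (E g : ι → ℝ) (ρ : ℝ) (h : ∀ i ∈ s, |E i| ≤ ρ * g i) :
    ∑ i ∈ s, |E i| ≤ ρ * ∑ i ∈ s, g i := by
  rw [Finset.mul_sum]
  exact Finset.sum_le_sum h

/-- ★ **THE TRUNCATION ERROR, ABSTRACT FORM.**  If a pairing splits as `main + Σ_B E·F` with a commutator `E` vanishing on `box p r` and off `box p s`,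
`|E| ≤ ρ·g` on the shell and `|F| ≤ θ` on `B`, `θ ≥ 0`, then `|pairing − main| ≤ θ·ρ·Σ_{shell} g`. [folklore] -/
theorem abs_sub_le_of_comm_split {B : Finset (Zd d)} {E F g : Zd d → ℝ} {p : Zd d} {r s : ℤ} {ρ θ pairing main : ℝ}
    (hsplit : pairing = main + ∑ x ∈ B, E x * F x) (hin : ∀ x ∈ box p r, E x = 0) (hout : ∀ x, x ∉ box p s → E x = 0)
    (hE : ∀ x ∈ box p s \ box p r, |E x| ≤ ρ * g x) (hF : ∀ x ∈ B, |F x| ≤ θ) (hθ : 0 ≤ θ) :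
    |pairing - main| ≤ θ * (ρ * ∑ x ∈ box p s \ box p r, g x) := by
  rw [hsplit, add_sub_cancel_left]
  refine (abs_sum_mul_le_of_abs_le B E F hF).trans (mul_le_mul_of_nonneg_left ?_ hθ)
  exact (sum_abs_le_sum_abs_shell E p r s hin hout B).trans (sum_abs_le_mul_sum_of_le _ E g ρ hE)

end Summit.QuantumFields.YangMills.Theorems.CovariantDischargeCutoffCommutator

end
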